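import Summits.Ventures.PercRepro.Night2OneFatColumnZero
import Summits.Ventures.PercRepro.Night2OneFatSourcesB

/-!
# PercRepro — a target with one coloop and at least eight points has at most three sources (night-2, gen 29)

The coloop `w` of `S ∖ K` is never a source (`(S ∖ w) ∖ K` has rank `4`, a lossy big face needs rank `5`), and by
`mem_coloops_of_source'` every other source lies among the three coloops of a first source's erasure, one of which is `w`.
So the sources (the points `y ∈ S` whose erasure has a lossy big face) are at most three: `C₀ ∖ {w}` and `y₀`.

* `faceLossP_eq_zero_of_mem_coloops`: no lossy big face below the erasure of a coloop;
* **`card_sources_le_three_of_one_coloop`**.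
-/

namespace PercRepro.Shadow

open Finset PerFlat ThmH

variable {α : Type*} [DecidableEq α] {M : Matroid α} [M.Finite] {G : Finset α}

section SourcesC

open scoped Classical in
/-- Erasing a coloop of `S ∖ K` leaves a set of rank `≤ 4` off `K`: no face of it is a lossy big member. -/
theorem faceLossP_eq_zero_of_mem_coloops (hG : G ∈ flatsQ M (5 + 1)) (hd : (gr M \ G).card = 2)
    (hk : kColoops M G = 1) (hs : ∀ e ∈ gr M, ∀ f ∈ gr M, e ≠ f → rkN M {e, f} = 2)
    (hl : ∀ e ∈ gr M, M.Indep {e}) {S : Finset α} (hSG : S ⊆ G) {w : α} (hw : w ∈ coloops M (S \ coloops M G))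
    {w' : α} (hw' : w' ∈ S.erase w) : faceLossP M 5 G (bigP M G) (S.erase w) w' = 0 := by
  by_contra h0
  obtain ⟨-, hr5, -, -, -, -⟩ := lossy_structure_of_faceLossP_ne_zero hG hd hk hs hl hw' h0
  have hGg : G ⊆ gr M := (mem_flatsQ.1 hG).1
  have heq : S.erase w \ coloops M G = (S \ coloops M G).erase w := by
    ext a; simp only [Finset.mem_sdiff, Finset.mem_erase]; tauto
  rw [heq] at hr5
  have h1 := rkN_erase_of_mem_coloops (M := M) (Finset.sdiff_subset.trans (hSG.trans hGg)) hw
  have h2 : rkN M (S \ coloops M G) ≤ rkN M (G \ coloops M G) :=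
    rkN_mono (Finset.sdiff_subset_sdiff hSG (Finset.Subset.refl _))
  rw [rkN_sdiff_coloops_eq_five hG hk] at h2
  omega

open scoped Classical in
/-- **AT MOST THREE SOURCES AT A TARGET WITH ONE COLOOP AND AT LEAST EIGHT POINTS OFF `K`** (cell `(2, 1)`): the points
`y ∈ S` whose erasure has a lossy big face are at most three. -/
theorem card_sources_le_three_of_one_coloop (hG : G ∈ flatsQ M (5 + 1)) (hd : (gr M \ G).card = 2)
    (hk : kColoops M G = 1) (hs : ∀ e ∈ gr M, ∀ f ∈ gr M, e ≠ f → rkN M {e, f} = 2)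
    (hl : ∀ e ∈ gr M, M.Indep {e}) {S : Finset α} (hSG : S ⊆ G) {w : α}
    (hc : coloops M (S \ coloops M G) = {w}) (h8 : 8 ≤ (S \ coloops M G).card) :
    (S.filter (fun y => ∃ w' ∈ S.erase y, faceLossP M 5 G (bigP M G) (S.erase y) w' ≠ 0)).card ≤ 3 := by
  have hGg : G ⊆ gr M := (mem_flatsQ.1 hG).1
  set Src := S.filter (fun y => ∃ w' ∈ S.erase y, faceLossP M 5 G (bigP M G) (S.erase y) w' ≠ 0) with hSrc
  have hwc : w ∈ coloops M (S \ coloops M G) := by rw [hc]; exact Finset.mem_singleton_self _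
  have hc1 : (coloops M (S \ coloops M G)).card ≤ 1 := by rw [hc, Finset.card_singleton]
  -- the coloop is not a source
  have hwSrc : w ∉ Src := by
    rw [hSrc, Finset.mem_filter]
    rintro ⟨-, w', hw', h0⟩
    exact h0 (faceLossP_eq_zero_of_mem_coloops hG hd hk hs hl hSG hwc hw')
  by_cases hSrc0 : Src = ∅
  · rw [hSrc0]; simp
  obtain ⟨y₀, hy₀⟩ := Finset.nonempty_iff_ne_empty.2 hSrc0
  have hy₀' := Finset.mem_filter.1 hy₀
  obtain ⟨w₀, hw₀, h0⟩ := hy₀'.2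
  obtain ⟨-, hQ₀5, hC₀, -, hR₀, -⟩ := lossy_structure_of_faceLossP_ne_zero hG hd hk hs hl hw₀ h0
  have hS5 : rkN M (S \ coloops M G) = 5 := by
    have ha : rkN M (S.erase y₀ \ coloops M G) ≤ rkN M (S \ coloops M G) :=
      rkN_mono (Finset.sdiff_subset_sdiff (Finset.erase_subset _ _) (Finset.Subset.refl _))
    have hb : rkN M (S \ coloops M G) ≤ rkN M (G \ coloops M G) :=
      rkN_mono (Finset.sdiff_subset_sdiff hSG (Finset.Subset.refl _))
    rw [rkN_sdiff_coloops_eq_five hG hk] at hb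
    omega
  -- the rest of the first source has at least four points
  have hR₀4 : 4 ≤ ((S.erase y₀ \ coloops M G) \ coloops M (S.erase y₀ \ coloops M G)).card := by
    have hy₀w : y₀ ≠ w := fun h => hwSrc (h ▸ hy₀)
    have hy₀K : y₀ ∉ coloops M G := by
      intro hK
      have heq : S.erase y₀ \ coloops M G = S \ coloops M G := by
        ext a; simp only [Finset.mem_sdiff, Finset.mem_erase]
        constructor
        · rintro ⟨⟨-, ha⟩, haK⟩; exact ⟨ha, haK⟩
        · rintro ⟨ha, haK⟩; exact ⟨⟨fun h => haK (h ▸ hK), ha⟩, haK⟩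
      rw [heq] at hC₀
      omega
    have hcard : (S.erase y₀ \ coloops M G).card + 1 = (S \ coloops M G).card := by
      have heq : S.erase y₀ \ coloops M G = (S \ coloops M G).erase y₀ := by
        ext a; simp only [Finset.mem_sdiff, Finset.mem_erase]; tauto
      rw [heq, Finset.card_erase_of_mem (Finset.mem_sdiff.2 ⟨hy₀'.1, hy₀K⟩)]
      have : 0 < (S \ coloops M G).card := Finset.card_pos.2 ⟨y₀, Finset.mem_sdiff.2 ⟨hy₀'.1, hy₀K⟩⟩
      omega
    have hCsub : coloops M (S.erase y₀ \ coloops M G) ⊆ S.erase y₀ \ coloops M G :=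
      fun a ha => (mem_coloops.1 ha).1
    have := Finset.card_sdiff_add_card_eq_card hCsub
    omega
  -- every other source is a coloop of the first's erasure, and not `w`
  have hsub : Src ⊆ insert y₀ ((coloops M (S.erase y₀ \ coloops M G)).erase w) := by
    intro y hy
    rw [Finset.mem_insert]
    by_cases hyy : y = y₀
    · exact Or.inl hyy
    · right
      have hy' := Finset.mem_filter.1 hy
      obtain ⟨w', hw', hw0⟩ := hy'.2
      obtain ⟨-, -, hC, -, -, -⟩ := lossy_structure_of_faceLossP_ne_zero hG hd hk hs hl hw' hw0
      have hyw : y ≠ w := fun h => hwSrc (h ▸ hy)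
      exact Finset.mem_erase.2 ⟨hyw,
        mem_coloops_of_source' hG hs hSG hS5 hc1 hy₀'.1 hy'.1 hyy hQ₀5 hC₀ hR₀ hR₀4 hC⟩
  -- `w` is a coloop of the first's erasure, so the erase removes a point
  have hwC₀ : w ∈ coloops M (S.erase y₀ \ coloops M G) := by
    have heq : S.erase y₀ \ coloops M G = (S \ coloops M G).erase y₀ := by
      ext a; simp only [Finset.mem_sdiff, Finset.mem_erase]; tauto
    rw [heq]
    exact mem_coloops_erase_of_mem_coloops hwc (fun h => hwSrc (h ▸ hy₀))
  have h1 := Finset.card_le_card hsub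
  have h2 := Finset.card_insert_le y₀ ((coloops M (S.erase y₀ \ coloops M G)).erase w)
  rw [Finset.card_erase_of_mem hwC₀, hC₀] at h2
  omega

end SourcesC

end PercRepro.Shadow
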